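import Summits.Ventures.HodgeRepro2.T5SchurIsotypicUnique

/-!
# T5SchurIsotypicStep4 — (A3) STEP 4 assembled: «exactly one π_∞ ∈ Ĝ_∞ has A_{π_∞} ≠ 0»

Cell pub-hodge-repro2, seat p5, Tier 5 (route/T5-N4-p5.md, N4.3 (A3) STEP 4, l. 147): «Let
P_π : L → L_π be the orthogonal projection; by (α) it commutes with R(G(𝔸)), so A_π := P_π|_{π₀} ∈
R(π₀, L_π) for the irreducible unitary G(𝔸)-module π₀.  If A_π ≠ 0, [Bo72] 5.5 makes π₀ equivalent
to a closed G(𝔸)-subrepresentation W of L_π […].  If A_{π′} ≠ 0 as well with π′ ≇ π, […] π ≅ π′: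
contradiction.  Since L = ⊕̂ L_π (γ) and π₀ ≠ 0, exactly one π_∞ ∈ Ĝ_∞ has A_{π_∞} ≠ 0.»

Kernel form.  `ρ` is a unitary representation of `G` on the Hilbert space `E` («L» with the
G_∞-action); for each index `π : P` an irreducible unitary `σ π` on `F π` and the «isotypic part»
`L π`, assumed to be the closed span of closed `ρ`-stable subspaces `H π i` each unitarily equivalent
to `σ π`; `W₀ ≠ ⊥` («π₀») a closed `ρ`-stable subspace whose restriction `ρW₀` is irreducible.

* `star_eq_of_inner`, `inner_map_map_of_star_eq`: the convention `star (ρ g) = ρ g⁻¹` is exactly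
  «every `ρ g` preserves the inner product»;
* `exists_restrictRep`: the restriction of `ρ` to a stable subspace exists as a monoid
  homomorphism into the operators of the subspace (a theorem, so that no definition is introduced);
* `stable_topologicalClosure`, `stable_topologicalClosure'`: closed spans of stable subspaces are
  stable; `topologicalClosure_eq_top_of_stable_ne_bot`: a non-zero stable subspace of an
  irreducible `ρ` is dense («N̄ = π₀ by irreducibility», (A4)(2)); `symm_apply_restrict`;
* `exists_linearIsometryEquiv_of_starProjection_ne_zero`: if the projections to `L π` and to `L π'`
  are both non-zero on `W₀`, then `σ π ≅ σ π'` — 5.5 realises `W₀` inside `L π` and inside `L π'`,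
  and `T5SchurIsotypicUnique.exists_linearIsometryEquiv_of_equiv` compares the two copies;
* `exists_starProjection_ne_zero_of_dense`: if the `L π` have dense span, some projection is non-zero
  on `W₀` («π₀ ≠ 0 and L = ⊕̂ L_π»);
* `existsUnique_starProjection_ne_zero`: for pairwise inequivalent `σ π`, EXACTLY ONE `π` has a
  non-zero projection on `W₀`;
* `le_of_forall_starProjection_eq_zero`, `existsUnique_le_isotypic`: hence `W₀` lies in exactly one
  isotypic part — «π₀ ⊂ L_{π_∞}», STEP 4's conclusion (pairwise orthogonality of the `L π` from
  STEP 3 (β), `T5SchurIsotypicUnique.isOrtho_closure_iSup_of_not_equiv`).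

Mathlib only besides the p5 files.  Axioms: propext, Classical.choice, Quot.sound.
-/

namespace Summit.Ventures.HodgeRepro2.T5SchurIsotypicStep4

open ContinuousLinearMap
open scoped InnerProductSpace

variable {E : Type*} [NormedAddCommGroup E] [InnerProductSpace ℂ E] [CompleteSpace E]
variable {G : Type*} [Group G]

omit [CompleteSpace E] in
/-- The restriction of `ρ` to a `ρ`-stable subspace `W`, as a representation on `W`. -/
theorem exists_restrictRep (ρ : G →* (E →L[ℂ] E)) {W : Submodule ℂ E}
    (hW : ∀ g, ∀ w ∈ W, ρ g w ∈ W) :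
    ∃ ρW : G →* (W →L[ℂ] W), ∀ g (w : W), (ρW g w : E) = ρ g w :=
  ⟨{ toFun := fun g => (ρ g).restrict (hW g)
     map_one' := ContinuousLinearMap.ext fun w => Subtype.ext (by
       simp only [restrict_apply, map_one, one_apply_eq_self])
     map_mul' := fun g h => ContinuousLinearMap.ext fun w => Subtype.ext (by
       simp only [restrict_apply, map_mul, mul_apply_eq_comp]) },
    fun _ _ => rfl⟩

/-- A representation preserving the inner product («unitary» in the usual sense) satisfies the
convention `star (ρ g) = ρ g⁻¹` used throughout the p5 files. -/
theorem star_eq_of_inner {ρ : G →* (E →L[ℂ] E)}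
    (h : ∀ g x y, ⟪ρ g x, ρ g y⟫_ℂ = ⟪x, y⟫_ℂ) (g : G) : star (ρ g) = ρ g⁻¹ := by
  rw [star_eq_adjoint]
  symm
  rw [eq_adjoint_iff]
  intro x y
  rw [← h g⁻¹ x (ρ g y), ← mul_apply_eq_comp, ← map_mul, inv_mul_cancel, map_one,
    one_apply_eq_self]

/-- Conversely, `star (ρ g) = ρ g⁻¹` for all `g` means that every `ρ g` preserves the inner
product. -/
theorem inner_map_map_of_star_eq {ρ : G →* (E →L[ℂ] E)} (hρ : ∀ g, star (ρ g) = ρ g⁻¹)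
    (g : G) (x y : E) : ⟪ρ g x, ρ g y⟫_ℂ = ⟪x, y⟫_ℂ := by
  rw [← adjoint_inner_right, ← star_eq_adjoint, hρ, ← mul_apply_eq_comp, ← map_mul,
    inv_mul_cancel, map_one, one_apply_eq_self]

omit [CompleteSpace E] in
/-- The closed span of `ρ`-stable subspaces is `ρ`-stable. -/
theorem stable_topologicalClosure {ρ : G →* (E →L[ℂ] E)} {ι : Type*} {H : ι → Submodule ℂ E}
    (hHs : ∀ i g, ∀ x ∈ H i, ρ g x ∈ H i) (g : G) :
    ∀ x ∈ (⨆ i, H i).topologicalClosure, ρ g x ∈ (⨆ i, H i).topologicalClosure := by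
  intro x hx
  have hstab : ∀ y ∈ (⨆ i, H i), ρ g y ∈ (⨆ i, H i) := by
    intro y hy
    refine Submodule.iSup_induction H (motive := fun y => ρ g y ∈ ⨆ i, H i) hy ?_ ?_ ?_
    · intro i y hy
      exact Submodule.mem_iSup_of_mem i (hHs i g y hy)
    · simp
    · intro y z hy hz
      rw [map_add]
      exact Submodule.add_mem _ hy hz
  exact map_mem_closure (ρ g).continuous hx hstab

omit [CompleteSpace E] in
/-- The closure of a single `ρ`-stable subspace is `ρ`-stable. -/
theorem stable_topologicalClosure' {ρ : G →* (E →L[ℂ] E)} {N : Submodule ℂ E}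
    (hN : ∀ g, ∀ x ∈ N, ρ g x ∈ N) (g : G) :
    ∀ x ∈ N.topologicalClosure, ρ g x ∈ N.topologicalClosure := by
  have h := stable_topologicalClosure (H := fun _ : Unit => N) (fun _ => hN) g
  simpa only [iSup_const] using h

omit [CompleteSpace E] in
/-- **(A4)(2), «N̄ = π₀ by irreducibility».**  A non-zero `ρ`-stable subspace (not necessarily
closed) of a topologically irreducible `ρ` is dense. -/
theorem topologicalClosure_eq_top_of_stable_ne_bot {ρ : G →* (E →L[ℂ] E)}
    (hirr : ∀ W : Submodule ℂ E, IsClosed (W : Set E) →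
      (∀ g, ∀ w ∈ W, ρ g w ∈ W) → W = ⊥ ∨ W = ⊤)
    {N : Submodule ℂ E} (hN : ∀ g, ∀ x ∈ N, ρ g x ∈ N) (hN0 : N ≠ ⊥) :
    N.topologicalClosure = ⊤ := by
  rcases hirr N.topologicalClosure (Submodule.isClosed_topologicalClosure _)
    (stable_topologicalClosure' hN) with hbot | htop
  · exact absurd (le_bot_iff.mp (hbot ▸ N.le_topologicalClosure)) hN0
  · exact htop

omit [CompleteSpace E] in
/-- An intertwining unitary equivalence onto a stable subspace intertwines backwards. -/
theorem symm_apply_restrict {ρ : G →* (E →L[ℂ] E)} {W₀ R : Submodule ℂ E}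
    (ρW₀ : G →* (W₀ →L[ℂ] W₀))
    (ρR : G →* (R →L[ℂ] R)) (hρR : ∀ g (w : R), (ρR g w : E) = ρ g w)
    (U : W₀ ≃ₗᵢ[ℂ] R) (hU : ∀ g x, (U (ρW₀ g x) : E) = ρ g (U x)) (g : G) (y : R) :
    U.symm (ρR g y) = ρW₀ g (U.symm y) := by
  apply U.injective
  rw [LinearIsometryEquiv.apply_symm_apply]
  apply Subtype.ext
  rw [hU, hρR, LinearIsometryEquiv.apply_symm_apply]

section Isotypic

variable {P : Type*} {F : P → Type*} [∀ π, NormedAddCommGroup (F π)]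
  [∀ π, InnerProductSpace ℂ (F π)] [∀ π, CompleteSpace (F π)]

/-- **STEP 4, the comparison.**  If the orthogonal projections onto the isotypic parts `L π` and
`L π'` are both non-zero on the irreducible `W₀`, then `σ π ≅ σ π'`. -/
theorem exists_linearIsometryEquiv_of_starProjection_ne_zero {ρ : G →* (E →L[ℂ] E)}
    (hρ : ∀ g, star (ρ g) = ρ g⁻¹)
    (σ : ∀ π, G →* (F π →L[ℂ] F π)) (hσ : ∀ π g, star (σ π g) = σ π g⁻¹)
    (hσirr : ∀ π, ∀ V : Submodule ℂ (F π), IsClosed (V : Set (F π)) →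
      (∀ g, ∀ v ∈ V, σ π g v ∈ V) → V = ⊥ ∨ V = ⊤)
    {ι : P → Type*} (H : ∀ π, ι π → Submodule ℂ E) (hHc : ∀ π i, IsClosed (H π i : Set E))
    (hHs : ∀ π i g, ∀ x ∈ H π i, ρ g x ∈ H π i)
    (U : ∀ π i, F π ≃ₗᵢ[ℂ] H π i) (hU : ∀ π i g x, ((U π i) (σ π g x) : E) = ρ g (U π i x))
    {W₀ : Submodule ℂ E} (hW₀c : IsClosed (W₀ : Set E))
    (ρW₀ : G →* (W₀ →L[ℂ] W₀)) (hρW₀ : ∀ g (w : W₀), (ρW₀ g w : E) = ρ g w)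
    (hW₀irr : ∀ C : Submodule ℂ W₀, IsClosed (C : Set W₀) →
      (∀ g, ∀ x ∈ C, ρW₀ g x ∈ C) → C = ⊥ ∨ C = ⊤)
    {π π' : P}
    (hπ : ∃ w ∈ W₀, ((⨆ i, H π i).topologicalClosure).starProjection w ≠ 0)
    (hπ' : ∃ w ∈ W₀, ((⨆ i, H π' i).topologicalClosure).starProjection w ≠ 0) :
    ∃ (t : ℝ) (V : F π ≃ₗᵢ[ℂ] F π'), 0 < t ∧ ∀ g x, V (σ π g x) = σ π' g (V x) := by
  haveI : CompleteSpace W₀ := hW₀c.completeSpace_coe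
  have hρW₀' : ∀ g, star (ρW₀ g) = ρW₀ g⁻¹ :=
    T5SchurIsotypicCopy.star_eq_of_coe_eq hρ hW₀c ρW₀ hρW₀
  -- the two isotypic parts, closed and stable
  have key : ∀ (q : P), (∃ w ∈ W₀, ((⨆ i, H q i).topologicalClosure).starProjection w ≠ 0) →
      ∃ (R : Submodule ℂ E) (ρR : G →* (R →L[ℂ] R)) (UR : W₀ ≃ₗᵢ[ℂ] R),
        IsClosed (R : Set E) ∧ R ≤ (⨆ i, H q i).topologicalClosure ∧ R ≠ ⊥ ∧
        (∀ g (w : R), (ρR g w : E) = ρ g w) ∧ ∀ g x, (UR (ρW₀ g x) : E) = ρ g (UR x) := by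
    intro q ⟨w, hwW, hw⟩
    set Lq : Submodule ℂ E := (⨆ i, H q i).topologicalClosure with hLq
    have hLqc : IsClosed (Lq : Set E) := Submodule.isClosed_topologicalClosure _
    have hLqs : ∀ g, ∀ x ∈ Lq, ρ g x ∈ Lq := fun g => stable_topologicalClosure (hHs q) g
    haveI : CompleteSpace Lq := hLqc.completeSpace_coe
    -- `A = P_{L q} ∘ (W₀ ↪ E)`, an intertwiner `ρW₀ → ρ`
    let A : W₀ →L[ℂ] E := Lq.starProjection ∘L W₀.subtypeL
    have hA : ∀ g, A ∘L ρW₀ g = ρ g ∘L A := by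
      intro g
      ext x
      simp only [A, comp_apply, Submodule.subtypeL_apply, hρW₀]
      have := DFunLike.congr_fun (T5SchurIff.starProjection_comm hρ hLqc hLqs g) (x : E)
      simpa only [comp_apply] using this
    have hA0 : A ≠ 0 := by
      intro h
      have := DFunLike.congr_fun h ⟨w, hwW⟩
      simp only [A, comp_apply, Submodule.subtypeL_apply, zero_apply] at this
      exact hw this
    obtain ⟨t, UR, ht, -, hUR⟩ :=
      T5SchurIntertwiner.exists_linearIsometryEquiv_range hρW₀' hρ hW₀irr hA hA0
    obtain ⟨t₀, ht₀, hAt₀⟩ :=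
      T5SchurIntertwiner.exists_pos_adjoint_comp_self_eq_smul_one hρW₀' hρ hW₀irr hA hA0
    have hRs : ∀ g, ∀ y ∈ LinearMap.range (A : W₀ →ₗ[ℂ] E),
        ρ g y ∈ LinearMap.range (A : W₀ →ₗ[ℂ] E) := T5SchurIntertwiner.range_stable hA
    obtain ⟨ρR, hρR⟩ := exists_restrictRep ρ hRs
    refine ⟨LinearMap.range (A : W₀ →ₗ[ℂ] E), ρR, UR,
      T5SchurIntertwiner.isClosed_range_coe ht₀ hAt₀, ?_, ?_, hρR, hUR⟩
    · rintro _ ⟨x, rfl⟩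
      exact Lq.starProjection_apply_mem _
    · intro hbot
      apply hA0
      have h0 : (A : W₀ →ₗ[ℂ] E) = 0 := LinearMap.range_eq_bot.mp hbot
      exact ContinuousLinearMap.coe_injective (by rw [h0]; rfl)
  obtain ⟨R, ρR, UR, hRc, hRle, hR0, hρR, hUR⟩ := key π hπ
  obtain ⟨R', ρR', UR', hR'c, hR'le, -, hρR', hUR'⟩ := key π' hπ'
  -- the comparison `Φ = UR' ∘ UR⁻¹ : R ≃ R'` intertwines the restrictions
  refine T5SchurIsotypicUnique.exists_linearIsometryEquiv_of_equiv hρ (hσ π) (hσirr π) (hσ π')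
    (hσirr π') (H π) (hHc π) (hHs π) (U π) (hU π) (H π') (hHc π') (hHs π') (U π') (hU π') hRc hRle
    hR'le hR0 ρR hρR ρR' hρR' (UR.symm.trans UR') fun g x => ?_
  rw [LinearIsometryEquiv.trans_apply, LinearIsometryEquiv.trans_apply,
    symm_apply_restrict ρW₀ ρR hρR UR hUR g x]
  apply Subtype.ext
  rw [hUR', hρR']

/-- If the isotypic parts `L π` have dense span, some projection is non-zero on `W₀ ≠ ⊥`. -/
theorem exists_starProjection_ne_zero_of_dense {ι : P → Type*} (H : ∀ π, ι π → Submodule ℂ E)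
    (hdense : (⨆ π, (⨆ i, H π i).topologicalClosure).topologicalClosure = ⊤)
    {W₀ : Submodule ℂ E} (hW₀0 : W₀ ≠ ⊥) :
    ∃ π, ∃ w ∈ W₀, ((⨆ i, H π i).topologicalClosure).starProjection w ≠ 0 := by
  obtain ⟨w, hwW, hw0⟩ := (Submodule.ne_bot_iff W₀).mp hW₀0
  obtain ⟨π, hπ⟩ := T5SchurIsotypicCopy.exists_starProjection_ne_zero
    (fun π => (⨆ i, H π i).topologicalClosure)
    (fun π => Submodule.isClosed_topologicalClosure _) (by rw [hdense]; trivial) hw0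
  exact ⟨π, w, hwW, hπ⟩

/-- **(A3) STEP 4.**  For pairwise inequivalent irreducible unitary `σ π` whose isotypic parts
`L π` (closed spans of copies of `σ π`) have dense span, EXACTLY ONE `π` has a non-zero orthogonal
projection `P_{L π}` on the irreducible `W₀ ≠ ⊥`: «exactly one π_∞ ∈ Ĝ_∞ has A_{π_∞} ≠ 0». -/
theorem existsUnique_starProjection_ne_zero {ρ : G →* (E →L[ℂ] E)}
    (hρ : ∀ g, star (ρ g) = ρ g⁻¹)
    (σ : ∀ π, G →* (F π →L[ℂ] F π)) (hσ : ∀ π g, star (σ π g) = σ π g⁻¹)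
    (hσirr : ∀ π, ∀ V : Submodule ℂ (F π), IsClosed (V : Set (F π)) →
      (∀ g, ∀ v ∈ V, σ π g v ∈ V) → V = ⊥ ∨ V = ⊤)
    (hne : ∀ π π', π ≠ π' → ∀ V : F π ≃ₗᵢ[ℂ] F π', ¬ ∀ g x, V (σ π g x) = σ π' g (V x))
    {ι : P → Type*} (H : ∀ π, ι π → Submodule ℂ E) (hHc : ∀ π i, IsClosed (H π i : Set E))
    (hHs : ∀ π i g, ∀ x ∈ H π i, ρ g x ∈ H π i)
    (U : ∀ π i, F π ≃ₗᵢ[ℂ] H π i) (hU : ∀ π i g x, ((U π i) (σ π g x) : E) = ρ g (U π i x))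
    (hdense : (⨆ π, (⨆ i, H π i).topologicalClosure).topologicalClosure = ⊤)
    {W₀ : Submodule ℂ E} (hW₀c : IsClosed (W₀ : Set E)) (hW₀0 : W₀ ≠ ⊥)
    (ρW₀ : G →* (W₀ →L[ℂ] W₀)) (hρW₀ : ∀ g (w : W₀), (ρW₀ g w : E) = ρ g w)
    (hW₀irr : ∀ C : Submodule ℂ W₀, IsClosed (C : Set W₀) →
      (∀ g, ∀ x ∈ C, ρW₀ g x ∈ C) → C = ⊥ ∨ C = ⊤) :
    ∃! π, ∃ w ∈ W₀, ((⨆ i, H π i).topologicalClosure).starProjection w ≠ 0 := by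
  obtain ⟨π, hπ⟩ := exists_starProjection_ne_zero_of_dense H hdense hW₀0
  refine ⟨π, hπ, fun π' hπ' => ?_⟩
  by_contra hne'
  obtain ⟨t, V, ht, hV⟩ := exists_linearIsometryEquiv_of_starProjection_ne_zero hρ σ hσ hσirr H
    hHc hHs U hU hW₀c ρW₀ hρW₀ hW₀irr hπ' hπ
  exact hne π' π hne' V hV

/-- If the closed subspaces `L π` are pairwise orthogonal with dense span and every projection
`P_{L π}`, `π ≠ π₀`, vanishes on `W₀`, then `W₀ ≤ L π₀` («v = Σ_π P_π v = P_{π_∞} v»). -/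
theorem le_of_forall_starProjection_eq_zero {L : P → Submodule ℂ E}
    (hLc : ∀ π, IsClosed (L π : Set E)) (horth : Pairwise fun π π' => L π ⟂ L π')
    (hdense : (⨆ π, L π).topologicalClosure = ⊤) {W₀ : Submodule ℂ E} {π₀ : P}
    (h : ∀ π, π ≠ π₀ → ∀ w ∈ W₀, (L π).starProjection w = 0) : W₀ ≤ L π₀ := by
  intro w hw
  haveI : CompleteSpace (L π₀) := (hLc π₀).completeSpace_coe
  have hy : ∀ π, w - (L π₀).starProjection w ∈ (L π)ᗮ := by
    intro π
    by_cases hπ : π = π₀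
    · subst hπ
      exact Submodule.sub_starProjection_mem_orthogonal (K := L π) w
    · haveI : CompleteSpace (L π) := (hLc π).completeSpace_coe
      have h1 : w ∈ (L π)ᗮ :=
        (Submodule.starProjection_apply_eq_zero_iff (L π)).mp (h π hπ w hw)
      have h2 : (L π₀).starProjection w ∈ (L π)ᗮ :=
        (horth (Ne.symm hπ)).le ((L π₀).starProjection_apply_mem w)
      exact Submodule.sub_mem _ h1 h2
  have hmem : w - (L π₀).starProjection w ∈ (⨆ π, L π)ᗮ := by
    rw [← Submodule.iInf_orthogonal, Submodule.mem_iInf]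
    exact hy
  rw [← Submodule.orthogonal_closure, hdense, Submodule.top_orthogonal_eq_bot, Submodule.mem_bot,
    sub_eq_zero] at hmem
  rw [hmem]
  exact (L π₀).starProjection_apply_mem w

/-- **(A3) STEP 4, final form: «π₀ ⊂ L_{π_∞}» for exactly one `π_∞`.**  Under the hypotheses of
`existsUnique_starProjection_ne_zero`, the irreducible `W₀` lies in EXACTLY ONE isotypic part
`L π = closure (⨆ i, H π i)`. -/
theorem existsUnique_le_isotypic {ρ : G →* (E →L[ℂ] E)}
    (hρ : ∀ g, star (ρ g) = ρ g⁻¹)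
    (σ : ∀ π, G →* (F π →L[ℂ] F π)) (hσ : ∀ π g, star (σ π g) = σ π g⁻¹)
    (hσirr : ∀ π, ∀ V : Submodule ℂ (F π), IsClosed (V : Set (F π)) →
      (∀ g, ∀ v ∈ V, σ π g v ∈ V) → V = ⊥ ∨ V = ⊤)
    (hne : ∀ π π', π ≠ π' → ∀ V : F π ≃ₗᵢ[ℂ] F π', ¬ ∀ g x, V (σ π g x) = σ π' g (V x))
    {ι : P → Type*} (H : ∀ π, ι π → Submodule ℂ E) (hHc : ∀ π i, IsClosed (H π i : Set E))
    (hHs : ∀ π i g, ∀ x ∈ H π i, ρ g x ∈ H π i)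
    (U : ∀ π i, F π ≃ₗᵢ[ℂ] H π i) (hU : ∀ π i g x, ((U π i) (σ π g x) : E) = ρ g (U π i x))
    (hdense : (⨆ π, (⨆ i, H π i).topologicalClosure).topologicalClosure = ⊤)
    {W₀ : Submodule ℂ E} (hW₀c : IsClosed (W₀ : Set E)) (hW₀0 : W₀ ≠ ⊥)
    (ρW₀ : G →* (W₀ →L[ℂ] W₀)) (hρW₀ : ∀ g (w : W₀), (ρW₀ g w : E) = ρ g w)
    (hW₀irr : ∀ C : Submodule ℂ W₀, IsClosed (C : Set W₀) →
      (∀ g, ∀ x ∈ C, ρW₀ g x ∈ C) → C = ⊥ ∨ C = ⊤) :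
    ∃! π, W₀ ≤ (⨆ i, H π i).topologicalClosure := by
  -- pairwise orthogonality of the isotypic parts (STEP 3 (β))
  have horth : Pairwise fun π π' =>
      (⨆ i, H π i).topologicalClosure ⟂ (⨆ i, H π' i).topologicalClosure := fun π π' hπ =>
    T5SchurIsotypicUnique.isOrtho_closure_iSup_of_not_equiv hρ (hσ π) (hσirr π) (hσ π')
      (hσirr π') (H π) (U π) (hU π) (H π') (hHc π') (hHs π') (U π') (hU π') (hne π π' hπ)
  obtain ⟨π, hπ, huniq⟩ := existsUnique_starProjection_ne_zero hρ σ hσ hσirr hne H hHc hHs U hU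
    hdense hW₀c hW₀0 ρW₀ hρW₀ hW₀irr
  refine ⟨π, ?_, fun π' hπ' => ?_⟩
  · refine le_of_forall_starProjection_eq_zero (fun π => Submodule.isClosed_topologicalClosure _)
      horth hdense fun π' hπ' w hw => ?_
    by_contra hne'
    exact hπ' (huniq π' ⟨w, hw, hne'⟩)
  · by_contra hne'
    obtain ⟨w', hw'W, hw'⟩ := hπ
    -- the projection to `L π` vanishes on `W₀ ≤ L π' ⊥ L π`, contradicting the choice of `π`
    haveI : CompleteSpace ((⨆ i, H π i).topologicalClosure) :=
      (Submodule.isClosed_topologicalClosure _).completeSpace_coe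
    apply hw'
    rw [Submodule.starProjection_apply_eq_zero_iff]
    exact (horth hne').le (hπ' hw'W)

end Isotypic

end Summit.Ventures.HodgeRepro2.T5SchurIsotypicStep4
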